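import Mathlib
import Literature.NumberTheory.DiophantineGeometry.AbcExceptionalSetEnergy
import HarnessLib

/-!
# Divisor-bound counting for the second and fourth moments

Topic `NumberTheory/DiophantineGeometry`; auxiliary file for the proof of
`Literature.NumberTheory.DiophantineGeometry.bernertEtAl2024_thm_1_2`
(Bernert–Browning–Lichtman–Teräväinen, arXiv:2410.12234 v2, Theorem 1.2), assembled in
`AbcExceptionalSetBoundsThm12Proofs`; it supplies the arithmetic inputs of the moment bounds
[cite: Bernert2025, Prop. 3, (2)–(3)] in abstract form:

* `pow_add_lt_pow_add` / `eq_of_sub_eq_of_pow_sub_eq`: for `e ≥ 1`, `j ≥ 2` the map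
  `t ↦ (t + e)^j − t^j` is strictly increasing on `ℕ`, so a pair of naturals `(a, b)` is determined
  by `a − b ≠ 0` and `a^j − b^j` (this replaces "roots of a polynomial of degree `j − 1`" in the
  source);
* `card_diffRep_le`: the number of `(k, a, b)` with `a ≠ b` and `(a^j − b^j) Q(k) = m ≠ 0` is at
  most `#{k : Q k ∣ |m|} · 2 τ(|m|)`;
* `card_E2_le`: `E₂ = #{F x = F x'} ≤ #𝒳 · R` when every value of `F` has `≤ R` preimages;
* `card_E4_le_keyed`: for a "split" `F x = (π x)^j Q(κ x)` (`j ≥ 2`, `x ↦ (π x, κ x)` injective),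
  `E₄ = #{F x − F x' = F x'' − F x'''} ≤ #K (#𝒳 E₂ + #𝒳² · 2 T₂ T₁)`, where `K ∋ κ x`,
  `T₁` bounds `#{k ∈ K : Q k ∣ m}` and `T₂` bounds `τ(m)` for `0 < m ≤ N` (`N ≥` all values of
  `F`). This is the keyed Cauchy–Schwarz inequality of `AbcExceptionalSetEnergy` followed by the
  case distinction `π x = π x''` (diagonal, `#𝒳 E₂`) / `π x ≠ π x''` (`card_diffRep_le`).

No definitions are introduced.
-/

open Finset

namespace Literature.NumberTheory.DiophantineGeometry

namespace AbcExceptional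

/-! ### Strict monotonicity of `t ↦ (t + e)^j - t^j` -/

/-- For `e ≥ 1`, `j ≥ 2` and `t < t'`: `(t + e)^j + t'^j < (t' + e)^j + t^j`, i.e.
`(t + e)^j − t^j < (t' + e)^j − t'^j` (binomial expansion: every term is monotone in `t`, the
term `j e^{j-1} t` strictly). [folklore] -/
theorem pow_add_lt_pow_add {j e t t' : ℕ} (hj : 2 ≤ j) (he : 0 < e) (htt : t < t') :
    (t + e) ^ j + t' ^ j < (t' + e) ^ j + t ^ j := by
  have expand : ∀ s : ℕ,
      (s + e) ^ j = s ^ j + ∑ i ∈ range j, s ^ i * e ^ (j - i) * j.choose i := by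
    intro s
    rw [add_pow, sum_range_succ]
    simp only [Nat.cast_id, Nat.choose_self, Nat.sub_self, pow_zero, mul_one]
    ring
  have hlt : ∑ i ∈ range j, t ^ i * e ^ (j - i) * j.choose i <
      ∑ i ∈ range j, t' ^ i * e ^ (j - i) * j.choose i := by
    apply sum_lt_sum
    · intro i _
      gcongr
    · refine ⟨1, mem_range.mpr (by omega), ?_⟩
      have h1 : 0 < e ^ (j - 1) * j.choose 1 := by
        rw [Nat.choose_one_right]
        exact Nat.mul_pos (pow_pos he _) (by omega)
      rw [pow_one, pow_one, mul_assoc, mul_assoc]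
      exact Nat.mul_lt_mul_of_pos_right htt h1
  rw [expand t, expand t']
  calc t ^ j + ∑ i ∈ range j, t ^ i * e ^ (j - i) * j.choose i + t' ^ j
      = (t ^ j + t' ^ j) + ∑ i ∈ range j, t ^ i * e ^ (j - i) * j.choose i := by ring
    _ < (t ^ j + t' ^ j) + ∑ i ∈ range j, t' ^ i * e ^ (j - i) * j.choose i :=
        Nat.add_lt_add_left hlt _
    _ = t' ^ j + ∑ i ∈ range j, t' ^ i * e ^ (j - i) * j.choose i + t ^ j := by ring

/-- Injectivity of `t ↦ (t + e)^j − t^j` (`e ≥ 1`, `j ≥ 2`), in subtraction-free form.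
[folklore] -/
theorem eq_of_pow_add_eq {j e b b' : ℕ} (hj : 2 ≤ j) (he : 0 < e)
    (h : (b + e) ^ j + b' ^ j = (b' + e) ^ j + b ^ j) : b = b' := by
  rcases lt_trichotomy b b' with h1 | h1 | h1
  · exact absurd h (ne_of_lt (pow_add_lt_pow_add hj he h1))
  · exact h1
  · have := pow_add_lt_pow_add hj he h1
    omega

/-- A pair of natural numbers `(a, b)` is determined by `a − b ≠ 0` and `a^j − b^j` (`j ≥ 2`).
[folklore] -/
theorem eq_of_sub_eq_of_pow_sub_eq {j : ℕ} (hj : 2 ≤ j) {a b a' b' : ℕ}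
    (hd : (a : ℤ) - b = a' - b') (hd0 : (a : ℤ) - b ≠ 0)
    (hpow : (a : ℤ) ^ j - (b : ℤ) ^ j = (a' : ℤ) ^ j - (b' : ℤ) ^ j) : a = a' ∧ b = b' := by
  rcases lt_or_gt_of_ne hd0 with hneg | hpos
  · -- `a < b`: write `b = a + e`, `b' = a' + e`
    obtain ⟨e, rfl⟩ : ∃ e, b = a + e := ⟨b - a, by omega⟩
    have he : 0 < e := by push_cast at hneg; omega
    have hb' : b' = a' + e := by push_cast at hd; omega
    subst hb'
    have h : (a + e) ^ j + a' ^ j = (a' + e) ^ j + a ^ j := by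
      have : ((a + e : ℕ) : ℤ) ^ j + (a' : ℤ) ^ j = ((a' + e : ℕ) : ℤ) ^ j + (a : ℤ) ^ j := by
        linear_combination -hpow
      exact_mod_cast this
    have := eq_of_pow_add_eq hj he h
    subst this
    exact ⟨rfl, rfl⟩
  · -- `a > b`: write `a = b + e`, `a' = b' + e`
    obtain ⟨e, rfl⟩ : ∃ e, a = b + e := ⟨a - b, by omega⟩
    have he : 0 < e := by push_cast at hpos; omega
    have ha' : a' = b' + e := by push_cast at hd; omega
    subst ha'
    have h : (b + e) ^ j + b' ^ j = (b' + e) ^ j + b ^ j := by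
      have : ((b + e : ℕ) : ℤ) ^ j + (b' : ℤ) ^ j = ((b' + e : ℕ) : ℤ) ^ j + (b : ℤ) ^ j := by
        linear_combination hpow
      exact_mod_cast this
    have := eq_of_pow_add_eq hj he h
    subst this
    exact ⟨rfl, rfl⟩

/-! ### Representations `(a^j - b^j) Q(k) = m` -/

/-- **Off-diagonal count.** For `m ≠ 0` and `j ≥ 2`, the number of `(k, a, b)` with `a ≠ b` and
`(a^j − b^j) Q(k) = m` is at most `#{k : Q k ∣ |m|} · 2τ(|m|)`: `a − b` is a signed divisor of
`m`, and then `(a, b)` is determined (`eq_of_sub_eq_of_pow_sub_eq`). [folklore] -/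
theorem card_diffRep_le {K : Type*} (Kf : Finset K) (Q : K → ℕ) (A : Finset ℕ)
    {j : ℕ} (hj : 2 ≤ j) (m : ℤ) (hm : m ≠ 0) (T₁ T₂ : ℕ)
    (hK : #{k ∈ Kf | Q k ∣ m.natAbs} ≤ T₁) (hτ : #(m.natAbs.divisors) ≤ T₂) :
    #{t ∈ Kf ×ˢ (A ×ˢ A) | t.2.1 ≠ t.2.2 ∧
        ((t.2.1 : ℤ) ^ j - (t.2.2 : ℤ) ^ j) * (Q t.1 : ℤ) = m} ≤ T₁ * (2 * T₂) := by
  classical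
  set Dv : Finset ℤ := (m.natAbs.divisors).image (fun d : ℕ => (d : ℤ)) ∪
      (m.natAbs.divisors).image (fun d : ℕ => -(d : ℤ)) with hDv_def
  have hDv : #Dv ≤ 2 * T₂ := by
    have h1 := card_image_le (s := m.natAbs.divisors) (f := fun d : ℕ => (d : ℤ))
    have h2 := card_image_le (s := m.natAbs.divisors) (f := fun d : ℕ => -(d : ℤ))
    calc #Dv ≤ _ + _ := card_union_le _ _
      _ ≤ T₂ + T₂ := Nat.add_le_add (h1.trans hτ) (h2.trans hτ)
      _ = 2 * T₂ := by ring
  calc #{t ∈ Kf ×ˢ (A ×ˢ A) | t.2.1 ≠ t.2.2 ∧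
          ((t.2.1 : ℤ) ^ j - (t.2.2 : ℤ) ^ j) * (Q t.1 : ℤ) = m}
      ≤ #({k ∈ Kf | Q k ∣ m.natAbs} ×ˢ Dv) := ?_
    _ = #{k ∈ Kf | Q k ∣ m.natAbs} * #Dv := card_product _ _
    _ ≤ T₁ * (2 * T₂) := Nat.mul_le_mul hK hDv
  refine card_le_card_of_injOn (fun t => (t.1, (t.2.1 : ℤ) - t.2.2)) ?_ ?_
  · intro t ht
    simp only [coe_filter, mem_product, Set.mem_setOf_eq] at ht
    obtain ⟨⟨hk, -, -⟩, hne, heq⟩ := ht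
    simp only [coe_product, coe_filter, Set.mem_prod, Set.mem_setOf_eq]
    refine ⟨⟨hk, ?_⟩, ?_⟩
    · have : (Q t.1 : ℤ) ∣ m := ⟨(t.2.1 : ℤ) ^ j - (t.2.2 : ℤ) ^ j, by rw [← heq]; ring⟩
      exact Int.natCast_dvd.mp this
    · set d : ℤ := (t.2.1 : ℤ) - t.2.2 with hd
      have hdm : d ∣ m := by
        have h1 : d ∣ (t.2.1 : ℤ) ^ j - (t.2.2 : ℤ) ^ j := sub_dvd_pow_sub_pow _ _ j
        rw [← heq]
        exact dvd_mul_of_dvd_left h1 _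
      have hdd : d.natAbs ∈ m.natAbs.divisors :=
        Nat.mem_divisors.mpr ⟨Int.natAbs_dvd_natAbs.mpr hdm, Int.natAbs_ne_zero.mpr hm⟩
      simp only [hDv_def, coe_union, coe_image, Set.mem_union, Set.mem_image, mem_coe]
      rcases Int.natAbs_eq d with h | h
      · exact Or.inl ⟨d.natAbs, hdd, h.symm⟩
      · exact Or.inr ⟨d.natAbs, hdd, by rw [h]; simp⟩
  · intro t ht t' ht' h
    simp only [coe_filter, mem_product, Set.mem_setOf_eq] at ht ht'
    obtain ⟨-, hne, heq⟩ := ht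
    obtain ⟨-, hne', heq'⟩ := ht'
    simp only [Prod.mk.injEq] at h
    obtain ⟨hk, hdiff⟩ := h
    have hQ0 : (Q t.1 : ℤ) ≠ 0 := by
      intro h0
      rw [h0, mul_zero] at heq
      exact hm heq.symm
    have hpow : (t.2.1 : ℤ) ^ j - (t.2.2 : ℤ) ^ j = (t'.2.1 : ℤ) ^ j - (t'.2.2 : ℤ) ^ j := by
      apply mul_right_cancel₀ hQ0
      rw [heq, hk, heq']
    have hd0 : (t.2.1 : ℤ) - t.2.2 ≠ 0 := by
      intro h0
      exact hne (by exact_mod_cast (sub_eq_zero.mp h0))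
    obtain ⟨h1, h2⟩ := eq_of_sub_eq_of_pow_sub_eq hj hdiff hd0 hpow
    exact Prod.ext hk (Prod.ext h1 h2)

/-! ### The second moment -/

/-- `E₂ = #{(x, x') : F x = F x'} ≤ #𝒳 · R` if every value of `F` is taken at most `R` times on
`𝒳`. [folklore] -/
theorem card_E2_le {α : Type*} (𝒳 : Finset α) (F : α → ℤ) (R : ℕ)
    (hR : ∀ x ∈ 𝒳, #{x' ∈ 𝒳 | F x' = F x} ≤ R) :
    #{p ∈ 𝒳 ×ˢ 𝒳 | F p.1 = F p.2} ≤ #𝒳 * R := by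
  classical
  have h : #{p ∈ 𝒳 ×ˢ 𝒳 | F p.1 = F p.2} = ∑ x ∈ 𝒳, #{x' ∈ 𝒳 | F x' = F x} := by
    rw [card_filter, sum_product]
    refine sum_congr rfl (fun x _ => ?_)
    rw [card_filter]
    refine sum_congr rfl (fun x' _ => ?_)
    simp only [eq_comm]
  rw [h]
  calc ∑ x ∈ 𝒳, #{x' ∈ 𝒳 | F x' = F x} ≤ ∑ x ∈ 𝒳, R := sum_le_sum hR
    _ = #𝒳 * R := by rw [sum_const, smul_eq_mul]

/-! ### The fourth moment for a split `F x = (π x)^j Q(κ x)` -/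

/-- **Keyed fourth-moment bound.** Let `F x = (π x)^j · Q(κ x)` on `𝒳` with `j ≥ 2` and
`x ↦ (π x, κ x)` injective, values `0 < F x ≤ N`, keys in `K`; suppose `#{k ∈ K : Q k ∣ m} ≤ T₁`
and `τ(m) ≤ T₂` for all `0 < m ≤ N`. Then
`E₄ = #{F x − F x' = F x'' − F x'''} ≤ #K · (#𝒳 · E₂ + #𝒳² · (T₁ · 2T₂))`.
(Physical-space version of [Bernert2025, proof of Prop. 3, bound (3)].) [cite: Bernert2025, Prop. 3] -/
theorem card_E4_le_keyed {α K : Type*} [DecidableEq α] [DecidableEq K] (𝒳 : Finset α)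
    (F : α → ℕ) (π : α → ℕ) (κ : α → K) (Q : K → ℕ) (Kf : Finset K) {j : ℕ} (hj : 2 ≤ j)
    (N T₁ T₂ : ℕ)
    (hF : ∀ x ∈ 𝒳, F x = π x ^ j * Q (κ x))
    (hinj : Set.InjOn (fun x => (π x, κ x)) 𝒳)
    (hK : ∀ x ∈ 𝒳, κ x ∈ Kf)
    (hpos : ∀ x ∈ 𝒳, 0 < F x) (hN : ∀ x ∈ 𝒳, F x ≤ N)
    (hT₁ : ∀ m : ℕ, 0 < m → m ≤ N → #{k ∈ Kf | Q k ∣ m} ≤ T₁)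
    (hT₂ : ∀ m : ℕ, 0 < m → m ≤ N → #(m.divisors) ≤ T₂) :
    #{q ∈ (𝒳 ×ˢ 𝒳) ×ˢ (𝒳 ×ˢ 𝒳) |
        (F q.1.1 : ℤ) - F q.1.2 = (F q.2.1 : ℤ) - F q.2.2} ≤
      #Kf * (#𝒳 * #{p ∈ 𝒳 ×ˢ 𝒳 | (F p.1 : ℤ) = F p.2} + #𝒳 ^ 2 * (T₁ * (2 * T₂))) := by
  classical
  -- keyed Cauchy–Schwarz
  have step1 := card_pairs_le_card_mul_card_keyed (𝒳 ×ˢ 𝒳) (fun p => (F p.1 : ℤ) - F p.2)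
    (fun p => κ p.1) Kf (fun p hp => hK p.1 (mem_product.mp hp).1)
  refine step1.trans (Nat.mul_le_mul_left _ ?_)
  -- split the keyed count along `π x = π x''`
  set S := {pq ∈ (𝒳 ×ˢ 𝒳) ×ˢ (𝒳 ×ˢ 𝒳) |
      (F pq.1.1 : ℤ) - F pq.1.2 = (F pq.2.1 : ℤ) - F pq.2.2 ∧ κ pq.1.1 = κ pq.2.1} with hS_def
  have memS : ∀ q ∈ S, ((q.1.1 ∈ 𝒳 ∧ q.1.2 ∈ 𝒳) ∧ (q.2.1 ∈ 𝒳 ∧ q.2.2 ∈ 𝒳)) ∧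
      (F q.1.1 : ℤ) - F q.1.2 = (F q.2.1 : ℤ) - F q.2.2 ∧ κ q.1.1 = κ q.2.1 := by
    intro q hq
    simpa only [hS_def, mem_filter, mem_product] using hq
  rw [← card_filter_add_card_filter_not (s := S) (fun q => π q.1.1 = π q.2.1)]
  refine Nat.add_le_add ?_ ?_
  · -- diagonal part: `x = x''`, then `F x' = F x'''`
    calc #{q ∈ S | π q.1.1 = π q.2.1}
        ≤ #(𝒳 ×ˢ {p ∈ 𝒳 ×ˢ 𝒳 | (F p.1 : ℤ) = F p.2}) := ?_
      _ = #𝒳 * #{p ∈ 𝒳 ×ˢ 𝒳 | (F p.1 : ℤ) = F p.2} := card_product _ _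
    refine card_le_card_of_injOn (fun q => (q.1.1, (q.1.2, q.2.2))) ?_ ?_
    · intro q hq
      obtain ⟨hq, hπ⟩ := mem_filter.mp hq
      obtain ⟨⟨⟨h11, h12⟩, ⟨h21, h22⟩⟩, heq, hκ⟩ := memS q hq
      have hxx : q.1.1 = q.2.1 := hinj h11 h21 (Prod.ext hπ hκ)
      simp only [coe_product, coe_filter, Set.mem_prod, mem_coe, Set.mem_setOf_eq, mem_product]
      refine ⟨h11, ⟨h12, h22⟩, ?_⟩
      rw [hxx] at heq
      linarith
    · intro q hq q' hq' h
      obtain ⟨hqS, hπ⟩ := mem_filter.mp hq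
      obtain ⟨hq'S, hπ'⟩ := mem_filter.mp hq'
      obtain ⟨⟨⟨h11, h12⟩, ⟨h21, h22⟩⟩, -, hκ⟩ := memS q hqS
      obtain ⟨⟨⟨h11', h12'⟩, ⟨h21', h22'⟩⟩, -, hκ'⟩ := memS q' hq'S
      have hxx : q.1.1 = q.2.1 := hinj h11 h21 (Prod.ext hπ hκ)
      have hxx' : q'.1.1 = q'.2.1 := hinj h11' h21' (Prod.ext hπ' hκ')
      simp only [Prod.mk.injEq] at h
      obtain ⟨ha, hb, hc⟩ := h
      refine Prod.ext (Prod.ext ha hb) (Prod.ext ?_ hc)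
      rw [← hxx, ← hxx', ha]
  · -- off-diagonal part: fibre over `(x', x''')`
    set S₂ := {q ∈ S | ¬ π q.1.1 = π q.2.1} with hS₂_def
    have hfib : ∀ w ∈ S₂.image (fun q => (q.1.2, q.2.2)),
        #{q ∈ S₂ | (q.1.2, q.2.2) = w} ≤ T₁ * (2 * T₂) := by
      intro w hw
      obtain ⟨q₀, hq₀, rfl⟩ := mem_image.mp hw
      obtain ⟨hq₀S, hπ₀⟩ := mem_filter.mp hq₀
      obtain ⟨⟨⟨-, h12⟩, ⟨-, h22⟩⟩, -, -⟩ := memS q₀ hq₀S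
      -- the common value `m = F x' - F x'''`
      set m : ℤ := (F q₀.1.2 : ℤ) - F q₀.2.2 with hm_def
      -- bound via `card_diffRep_le`, provided `m ≠ 0`
      by_cases hm0 : m = 0
      · -- then the fibre is empty: `a ≠ b` forces `F x ≠ F x''`
        have : {q ∈ S₂ | (q.1.2, q.2.2) = (q₀.1.2, q₀.2.2)} = ∅ := by
          refine filter_eq_empty_iff.mpr (fun q hq hw' => ?_)
          obtain ⟨hqS, hπ⟩ := mem_filter.mp hq
          obtain ⟨⟨⟨h11, -⟩, ⟨h21, -⟩⟩, heq, hκ⟩ := memS q hqS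
          simp only [Prod.mk.injEq] at hw'
          rw [hw'.1, hw'.2] at heq
          have hFF : (F q.1.1 : ℤ) = F q.2.1 := by
            have : (F q.1.1 : ℤ) - F q.2.1 = m := by rw [hm_def]; linarith
            rw [hm0] at this
            linarith
          apply hπ
          have h1 : F q.1.1 = F q.2.1 := by exact_mod_cast hFF
          rw [hF _ h11, hF _ h21, hκ] at h1
          have hQpos : 0 < Q (κ q.2.1) := by
            have h0 := hpos _ h21
            rw [hF _ h21] at h0
            refine Nat.pos_of_ne_zero (fun hz => ?_)
            rw [hz, mul_zero] at h0
            exact lt_irrefl 0 h0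
          exact Nat.pow_left_injective (by omega) (Nat.eq_of_mul_eq_mul_right hQpos h1)
        rw [this, card_empty]
        exact Nat.zero_le _
      · have hmN : m.natAbs ≤ N := by
          have h1 := hN _ h12
          have h2 := hN _ h22
          have h3 := hpos _ h12
          have h4 := hpos _ h22
          rw [hm_def]
          omega
        have hmpos : 0 < m.natAbs := Int.natAbs_pos.mpr hm0
        calc #{q ∈ S₂ | (q.1.2, q.2.2) = (q₀.1.2, q₀.2.2)}
            ≤ #{t ∈ Kf ×ˢ (𝒳.image π ×ˢ 𝒳.image π) | t.2.1 ≠ t.2.2 ∧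
                ((t.2.1 : ℤ) ^ j - (t.2.2 : ℤ) ^ j) * (Q t.1 : ℤ) = m} := ?_
          _ ≤ T₁ * (2 * T₂) :=
              card_diffRep_le Kf Q (𝒳.image π) hj m hm0 T₁ T₂ (hT₁ _ hmpos hmN) (hT₂ _ hmpos hmN)
        refine card_le_card_of_injOn (fun q => (κ q.1.1, (π q.1.1, π q.2.1))) ?_ ?_
        · intro q hq
          obtain ⟨hq2, hw'⟩ := mem_filter.mp hq
          obtain ⟨hqS, hπ⟩ := mem_filter.mp hq2
          obtain ⟨⟨⟨h11, -⟩, ⟨h21, -⟩⟩, heq, hκ⟩ := memS q hqS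
          simp only [Prod.mk.injEq] at hw'
          simp only [coe_filter, mem_product, mem_image, Set.mem_setOf_eq]
          refine ⟨⟨hK _ h11, ⟨_, h11, rfl⟩, ⟨_, h21, rfl⟩⟩, hπ, ?_⟩
          rw [hw'.1, hw'.2] at heq
          have e1 := hF _ h11
          have e2 := hF _ h21
          rw [← hκ] at e2
          have : (F q.1.1 : ℤ) - F q.2.1 = m := by rw [hm_def]; linarith
          rw [← this, e1, e2]
          push_cast
          ring
        · intro q hq q' hq' h
          obtain ⟨hq2, hw⟩ := mem_filter.mp hq
          obtain ⟨hqS, -⟩ := mem_filter.mp hq2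
          obtain ⟨⟨⟨h11, -⟩, ⟨h21, -⟩⟩, -, hκ⟩ := memS q hqS
          obtain ⟨hq2', hw'⟩ := mem_filter.mp hq'
          obtain ⟨hqS', -⟩ := mem_filter.mp hq2'
          obtain ⟨⟨⟨h11', -⟩, ⟨h21', -⟩⟩, -, hκ'⟩ := memS q' hqS'
          simp only [Prod.mk.injEq] at h hw hw'
          obtain ⟨hk, ha, hb⟩ := h
          have e1 : q.1.1 = q'.1.1 := hinj h11 h11' (Prod.ext ha hk)
          have e2 : q.2.1 = q'.2.1 :=
            hinj h21 h21' (Prod.ext hb (by show κ q.2.1 = κ q'.2.1; rw [← hκ, hk, hκ']))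
          refine Prod.ext (Prod.ext e1 ?_) (Prod.ext e2 ?_)
          · rw [hw.1, hw'.1]
          · rw [hw.2, hw'.2]
    calc #S₂ ≤ T₁ * (2 * T₂) * #(S₂.image (fun q => (q.1.2, q.2.2))) :=
          card_le_mul_card_image _ _ hfib
      _ ≤ T₁ * (2 * T₂) * #(𝒳 ×ˢ 𝒳) := by
          refine Nat.mul_le_mul_left _ (card_le_card ?_)
          intro w hw
          obtain ⟨q, hq, rfl⟩ := mem_image.mp hw
          obtain ⟨hqS, -⟩ := mem_filter.mp hq
          obtain ⟨⟨⟨-, h12⟩, ⟨-, h22⟩⟩, -, -⟩ := memS q hqS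
          exact mem_product.mpr ⟨h12, h22⟩
      _ = #𝒳 ^ 2 * (T₁ * (2 * T₂)) := by rw [card_product]; ring

end AbcExceptional

end Literature.NumberTheory.DiophantineGeometry
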